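import Summits.BirchSwinnertonDyer.BirchSwinnertonDyer.Theorems.SignedLowerHalvesSprungLowerHalfAtThreeTwistBootstrapCrux
import Summits.BirchSwinnertonDyer.BirchSwinnertonDyer.Theorems.AdditiveBranchIMCGordTwoRankOneHeegnerKolyvaginTwist
import Summits.BirchSwinnertonDyer.Rank1Residual.X11b.BDPRouteSurj
import Summits.BirchSwinnertonDyer.Rank1Residual.X11b.TwistTransportRam
import Summits.BirchSwinnertonDyer.Rank1Residual.Partition.MainConjecturesAnticyclotomicClass
import Summits.BirchSwinnertonDyer.Rank1Residual.O5.HeegnerTwistTamagawaThree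
import Literature.NumberTheory.EllipticCurves.HeegnerHypothesisKroneckerProofs
import HarnessLib

/-!
# Leaf X8 (`p = 3` good supersingular, `a₃ = ±3`), analytic rank ONE: `BSD(E,3)` on the ANTICYCLOTOMIC
# TWIST-CERTIFICATE road — Jetchev–Skinner–Wan 2017 Thm. 3.3.1, Gross–Zagier, Kolyvagin's index bound and
# Wuthrich 2014 Prop. 21 BY NAME + ONE displayed anticyclotomic Eisenstein link + ONE numerical twist certificate
# (cell `bsd-print-x8`, D-0131 (2) print tier, prover seat p4 «TWC road»; `--supports` item
# stmt-BirchSwinnertonDyer-19004 `SharpFlatResiduePPart` (the X8 ∧ r = 1 residual of route `SignedLowerHalves`);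
# theorems only; the rank-ONE companion of k3-c5's rank-ZERO twist bootstrap
# `Theorems/SignedLowerHalvesSprungLowerHalfAtThreeTwistBootstrap{,Crux}.lean`; closes nothing)

HONEST FRAMING (cell bsd-print-x8, HOME run/shared/lean/pub/bsd-print-x8/): PARTITION currency — the leaf
`Summit.BirchSwinnertonDyer.WAllCornerX8` counts only when its class theorem is in the kernel BY NAME, flag-free.
This file does NOT prove it. It records, sorry-free and with every published input BY NAME, what the
anticyclotomic (♯♭-free, `a_p`-BLIND) road needs beyond print on X8 ∧ {`r_an = 1`}: ONE displayed link
`hLA` — the Eisenstein-side divisibility of the anticyclotomic Iwasawa–Greenberg (BDP) main conjecture at the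
trivial character for `(E, 3, K)`, composed with the BDP formula, in valuation currency on the tree's
constructed `X_ac` (`X11b.IMCLowerWaldspurgerOnTreeGoodAt 3 κ 𝔭 γ (embAt K 3 𝔭) P`). «beyond-print theorem:
NO». Print status of `hLA` at `(3, a₃ = ±3)` and a CLASSICAL Heegner field (every `ℓ ∣ N` split): NOT IN
PRINT — Castella–Liu–Wan, Forum Math. Sigma 10 (2022) e110, Thm. 8.2.1 (the two-variable Greenberg
divisibility; «`p ≥ 3`», `π_p` unramified of ANY slope, `π_v` unramified-or-Steinberg for all `v`, i.e. `N`
square-free) needs a prime `q ∣ N` NON-split in `K`; its anticyclotomic specialisation is printed only for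
`p ≥ 5`, `a_p = 0` (Castella–Wan, Math. Ann. 389 (2024) Thm. 5.3); Burungale–Büyükboduk–Lei, Adv. Math. 439
(2024) has «`p ≥ 5`», `p ∤ 6N₀`; Castella–Çiperiani–Skinner–Sprung arXiv:1804.10993 (any non-ordinary `p > 2`,
semistable) is a PREPRINT. So the class-wide NAMED RESIDUAL CRUX of the TWC road on X8 is exactly the one k3-c5
displayed for `r_an = 0` (object «LOW0-TWIST», p476757): the anticyclotomic Eisenstein divisibility at
`(3, ±3)`; per pair the remaining inputs are NUMERICAL (a twist certificate, below) and kernel-decidable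
side conditions.

## The road at an X8 pair with `ord_{s=1} L(E,s) = 1` (JSW 2017 §7.4 architecture, `p = 3`, `a₃ = ±3`)

DATA (one classical Heegner datum + ONE certificate): `K = ℚ(√d_K)` imaginary quadratic with every
`ℓ ∣ N = N_E` split (`hHN`), `3` split (`hHp`), `3 ∤ #𝓞_K^×` (`hμ`); a parametrisation datum `Dt` of level
`N` with `3 ∤ c(Dt)` (`hc`; in print Mazur 1978: `3 ∤ N`), Heegner datum `H`, Heegner point `P ∈ E(K)`; a
globally minimal model `Wd = Cd • E^{(d_K)}` of the RANK-ZERO twist; the CERTIFICATE: `L(E^{(d_K)},1) ≠ 0`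
(`hLt`) and the twist lies in the 3-adic Tamagawa ZONE `ord₃(L(Wd,1)/Ω) + 2·ord₃ #Wd(ℚ)_tors ≤ ord₃ ∏c(Wd)`
(`hzone`; equivalently `3 ∤ #Ш_an(Wd)` — a rational number computed by modular symbols / two numerical
engines); side conditions `ρ̄_{E,3}` onto (`hsurj`: automatic for semistable X8, `ClassX8.surj_of_semistable`;
kernel certificate otherwise) and `3 ∤ ∏_ℓ c_ℓ(E)` (`htam0`: Kolyvagin's bound is blind to the Tamagawa term).
* UPPER half `ord₃ #Ш(E) ≤ ord₃ #Ш_an(E)`: Kolyvagin 1990 Thm. A BY NAME (`hB`, «`p ≠ 2`», `ρ̄` onto — no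
  hypothesis on the reduction at `3`) + the Gross–Zagier bookkeeping identity + the ZONE of the twist —
  the cell's class-agnostic `X11b.missingUpperBoundAt_of_shaIndexBound` (JSW §7.4.2 (eq:shaupper)).
* LOWER half `ord₃ #Ш_an(E) ≤ ord₃ #Ш(E)`: CONTROL = Jetchev–Skinner–Wan 2017 Thm. 3.3.1 + (3.5.d) BY NAME
  (`h331`, «`p ≥ 3`, `p ∤ N`», no ordinarity; the local term carries `1 − a₃ + 3 ∈ {1, 7}`, 3-adic units;
  `E[3]∣G_K` irreducible by Serre 1972 Prop. 12 at a quadratic field, tree THEOREM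
  `hasIrreducibleModPGaloisRep_baseChange_of_dvd_frobeniusTrace`) through `X11b.controlOnTreeGoodAt_of_thm331_embAt`
  at an anticyclotomic datum that EXISTS (`X11b.exists_anticyclotomic_generator_prime`); the ONE DISPLAYED LINK
  `hLA` = (IMC≥∘BDP)ᵍ; the JSW lower bound (eq:shalowerK-1) in index currency, ANY prime
  (`X11b.indexLowerBoundAt_of_onTreeGoodLowerLinks_of_allSplit`); and the rank-zero UPPER bound for the TWIST —
  Wuthrich 2014 Prop. 21 BY NAME (`hW`; `Wd` is GOOD at `3` since `3` splits in `K`, tree theorems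
  `isSquare_discr_padic_of_heegner` + `hasGoodReductionAtPrime_quadraticTwist_iff_of_isSquare`; `ρ̄_{Wd,3}` onto by
  `X11b.surj_twist_model`) — the cell's `X11b.missingLowerBoundAt_of_indexLowerBoundAt` (JSW §7.4.1).
* The transports at `3` are tree THEOREMS: `ord₃ u(Cd) = 0` (`X11b.padicValRat_u_eq_zero_of_twist_good`),
  `ord₃ ∏c(Wd) = ord₃ ∏c(E)` (`O5.TwistTamagawa.padicValNat_tamagawaProduct_twist_of_heegner_three`), `3 ∤ d_K`
  (`SatisfiesHeegnerHypothesis.not_dvd_discr`).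

Contents: §1 `leHalf_rankZero_of_wuthrich` (the twist's `≤`-half in the `htw` shape, from Wuthrich Prop. 21
BY NAME — PROVED bookkeeping); §2 `X8.bsdp_rankOne_of_acLowerLink_of_twistCertificate` (datum level; every
transport discharged); §3 `X8.bsdp_rankOne_of_twistCertificateRoad` (the ∀∃ reading over X8 ∧ {r = 1, surj(3),
3 ∤ ∏c}); §4 `X8.bsdp_of_acRoads_of_surj` (the LEAF reading on X8 ∧ {surj(3)}, `r_an ≤ 1`: rank 0 by k3-c5's
twist-pair bootstrap `X8.low0_of_twistBootstrapRoad` + Wuthrich, rank 1 by §3 — BOTH ranks modulo the SAME one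
displayed link). CONDITIONAL on `hLA` and the per-pair data; nothing about any curve is asserted; closes nothing;
0 census moves. The per-pair certificate census of the 217 open X8 cells (bsd-ssimc `A8_x8_open_cells.v3.tsv`)
is this seat's kit job (HOME/STATUS.md), not this file.

References: [JetchevSkinnerWan2017] Thm. 3.3.1 with §3.5 (3.5.d), §7.4.1 (eq:shalowerK-1)–(eq:shalower),
§7.4.2 (eq:shaupper) (arXiv:1512.06894 pp. 11, 16, 30–31); [KolyvaginEulerSystems1990] Thm. A; [McCallumLMS1991]
§1; [Wuthrich2014] Prop. 21 (p. 400); [GrossZagier1986] I.(6.3), V.§2; [GrossLMS1991] Thm. 1.3; [Mazur1978]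
Cor. 4.1; [Serre1972] §1.11 Prop. 12; [CastellaLiuWan2022] §5.2, Thm. 8.2.1; [CastellaWan2023] Thm. 5.3;
[BurungaleBuyukbodukLei2024] Thm. 1.1 («p ∤ 6N₀»); [CastellaCiperianiSkinnerSprung2018] Thms. C/D (PRE);
[Miller2011LMS] Def. 1.1.
-/

set_option autoImplicit false
set_option linter.dupNamespace false

noncomputable section

open scoped Classical NumberField

open WeierstrassCurve NumberField IsDedekindDomain Literature.NumberTheory.EllipticCurves
  Literature.NumberTheory.EllipticCurves.ModularForms
  Literature.NumberTheory.EllipticCurves.Rank1Residual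
  Literature.NumberTheory.EllipticCurves.Rank1Residual.Typed
  Literature.NumberTheory.EllipticCurves.KrizLi2019
  Summit.BirchSwinnertonDyer.Rank1Residual

namespace Summit.BirchSwinnertonDyer.BirchSwinnertonDyer.Theorems.X8TwistCertificate

/-! ### §1. The rank-zero twist's `≤`-half from Wuthrich 2014 Prop. 21 BY NAME (bookkeeping) -/

/-- **The `≤`-half of the rank-zero `p`-part of a GOOD, SURJECTIVE rank-zero curve, in the `htw` shape of
`X11b.missingLowerBoundAt_of_indexLowerBoundAt`** — `ord_p #Ш(E') + ord_p ∏c(E') − 2·ord_p #E'(ℚ)_tors ≤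
ord_p(L(E',1)/Ω_{E'})` — from Wuthrich, Doc. Math. 19 (2014) Prop. 21 (`hW`, PUBLISHED: at an odd prime of
non-additive reduction with `ρ̄_{E',p}` onto, `ord_p #Ш ≤ ord_p #Ш_an`), read on the modular-symbol rational
`L(E',1)/Ω ∈ ℚ` (`hmodP`, `X1.RankZeroPartner.exists_rat_entireLFunction_one_div_realPeriodRat`) through
`#Ш_an = (L/Ω)·#tors²/∏c` (`Supersingular.shaAn_eq_of_analyticRank_eq_zero`); no rational `p`-torsion by
irreducibility. Used for the Heegner twist `Wd` of a rank-one X8 curve at `p = 3`.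
[cite: Wuthrich2014, Prop. 21 (p. 400)] [cite: Miller2011LMS, §1 and Def. 1.1] -/
theorem leHalf_rankZero_of_wuthrich (hW : Wuthrich2014.sha_dvd_analyticSha)
    (hGZK : rank_eq_analyticRank_of_analyticRank_le_one) (hmod : hasEntireLFunction_rat)
    (hmodP : nonempty_modularParametrizationData)
    (Wd : WeierstrassCurve ℚ) [Wd.IsElliptic] [Wd.IsGloballyMinimal] (p : ℕ) [Fact p.Prime] (hp2 : p ≠ 2)
    (hL : Wd.entireLFunction 1 ≠ 0) (hgood : Wd.HasGoodReductionAtPrime p)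
    (hsurj : Wd.HasSurjectiveModNGaloisRep p) :
    ∃ q : ℚ, Wd.entireLFunction 1 / (Wd.realPeriodRat : ℂ) = (q : ℂ) ∧
      (padicValNat p Wd.shaOrder : ℤ) + padicValNat p Wd.tamagawaProduct -
        2 * padicValNat p Wd.torsionOrder ≤ padicValRat p q := by
  have hr0 : Wd.analyticRank = 0 := (Wd.analyticRank_eq_zero_iff_holds (hmod Wd)).2 hL
  have hadd : ¬ ((Wd.baseChange ℚ_[p]).minimal ℤ_[p]).HasAdditiveReduction ℤ_[p] :=
    WeierstrassCurve.HasGoodReduction.not_hasAdditiveReduction (R := ℤ_[p]) hgood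
  obtain ⟨q', hq', hle⟩ := missingUpperBoundAt_of_wuthrich Wd p hW hGZK hmod hp2 hr0 hadd (Or.inr hsurj)
  obtain ⟨t, ht⟩ := X1.RankZeroPartner.exists_rat_entireLFunction_one_div_realPeriodRat hmodP Wd
  have hshaAn := Supersingular.shaAn_eq_of_analyticRank_eq_zero Wd hGZK hr0 ht
  have hqq : q' = t * (Wd.torsionOrder : ℚ) ^ 2 / (Wd.tamagawaProduct : ℚ) := by
    exact_mod_cast hq'.symm.trans hshaAn
  have ht0 : t ≠ 0 := by
    intro h0
    apply hL
    have hΩ : (Wd.realPeriodRat : ℂ) ≠ 0 := Complex.ofReal_ne_zero.mpr Wd.realPeriodRat_pos_holds.ne'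
    have := (div_eq_iff hΩ).mp ht
    rw [this, h0]; simp
  have hirr : Wd.HasIrreducibleModPGaloisRep p :=
    hasIrreducibleModPGaloisRep_of_hasSurjectiveModNGaloisRep Wd p hsurj
  have htors : padicValNat p Wd.torsionOrder = 0 := padicValNat_torsionOrder_eq_zero_of_irreducible Wd p hirr
  rw [hqq, Supersingular.padicValRat_shaAn_witness Wd p hirr ht0] at hle
  refine ⟨t, ht, ?_⟩
  have e0 : (padicValNat p Wd.torsionOrder : ℤ) = 0 := by exact_mod_cast htors
  linarith

/-! ### §2. Datum level: `BSD(E,3)` at a rank-one X8 pair from ONE displayed link and ONE twist certificate -/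

/-- **`BSD(E,3)` at a RANK-ONE X8 pair on the anticyclotomic TWIST-CERTIFICATE road.** DATA: `W` globally
minimal on class X8 (`p = 3` good supersingular, `a₃ = ±3`) with `ord_{s=1} L(E,s) = 1` (`hr`), `ρ̄_{E,3}`
onto (`hsurj`), `3 ∤ ∏_ℓ c_ℓ(E)` (`htam0`); a classical Heegner datum — `K` imaginary quadratic with every
`ℓ ∣ N = N_E` split (`hHN`) and `3` split (`hHp`), `3 ∤ #𝓞_K^×` (`hμ`), a parametrisation datum `Dt` of
level `N` with `3 ∤ c(Dt)` (`hc`), Heegner datum `H`, Heegner point `P ∈ E(K)` (`hP`); a globally minimal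
model `Wd = Cd • E^{(d_K)}` of the twist; the CERTIFICATE: `L(E^{(d_K)},1) ≠ 0` (`hLt`) and the 3-adic
Tamagawa ZONE of the twist `ord₃(L(Wd,1)/Ω) + 2·ord₃ #Wd(ℚ)_tors ≤ ord₃ ∏c(Wd)` (`hzone`, numerical: no Ш
input). PUBLISHED BY NAME: `h331` (JSW 2017 Thm. 3.3.1 + (3.5.d), general form), `hGZ` (Gross–Zagier), `hKo`
(Kolyvagin, qualitative), `hB` (Kolyvagin's index bound), `hW` (Wuthrich 2014 Prop. 21), `hGZK`, `hmod`,
`hmodP`. DISPLAYED: `hLA` — (IMC≥∘BDP)ᵍ at `P` for every anticyclotomic `κ`, generator `γ`, degree-one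
`𝔭 ∋ 3` with THE embedding (route R1's idiom) — OPEN, NOT IN PRINT at `(3, ±3)` and a classical Heegner field
(module docstring). Every transport at `3` (good reduction and surjectivity of the twist, `ord₃ u = 0`, the
Tamagawa transport, `3 ∤ d_K`) is DISCHARGED by tree theorems. CONCLUSION: Miller's `BSD(E,3)` = upper half
(Kolyvagin + zone, `X11b.missingUpperBoundAt_of_shaIndexBound`) ∧ lower half (JSW control by name + `hLA` +
Wuthrich for the twist, `X11b.missingLowerBoundAt_of_indexLowerBoundAt`). CONDITIONAL on `hLA` and the data;
closes nothing. [cite: JetchevSkinnerWan2017, Thm. 3.3.1 with §3.5 (3.5.d), §7.4.1–§7.4.2 (arXiv:1512.06894 pp. 11, 16, 30–31)]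
[cite: McCallumLMS1991, §1 Theorem (Kolyvagin), p. 296] [cite: KolyvaginEulerSystems1990, Thm. A]
[cite: Wuthrich2014, Prop. 21 (p. 400)] [cite: GrossZagier1986, I.(6.3) and V.§2] [cite: GrossLMS1991, Thm. 1.3]
[cite: Serre1972, §1.11 Prop. 12] [cite: Miller2011LMS, §1 and Def. 1.1] -/
theorem X8.bsdp_rankOne_of_acLowerLink_of_twistCertificate
    (hW : Wuthrich2014.sha_dvd_analyticSha)
    (h331 : JetchevSkinnerWan2017.thm331_anticyclotomicControl_general)
    (hGZK : rank_eq_analyticRank_of_analyticRank_le_one) (hmod : hasEntireLFunction_rat)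
    (hmodP : nonempty_modularParametrizationData)
    (W : WeierstrassCurve ℚ) [W.IsElliptic] [W.IsGloballyMinimal] (hX : ClassX8 W 3)
    (hr : W.analyticRank = 1) (hsurj : Surj W 3) (htam0 : ¬ (3 : ℕ) ∣ W.tamagawaProduct)
    (N : ℕ) [NeZero N] (hN : W.conductorNorm ℤ = N) (K : Type) [Field K] [NumberField K]
    (hGZ : gross_zagier N W K) (hKo : kolyvagin N W K) (hB : Kolyvagin1990_padicValNat_card_sha_le N W K)
    (hK : IsImaginaryQuadratic K) (hHN : SatisfiesHeegnerHypothesis N K)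
    (hHp : SatisfiesHeegnerHypothesis 3 K)
    (Dt : ModularParametrizationData W N) (H : HeegnerDatum N (NumberField.discr K)) (ιC : K →+* ℂ)
    (P : (W.baseChange K).toAffine.Point)
    (hP : WeierstrassCurve.Affine.Point.map ιC.toRatAlgHom P = heegnerPointComplex Dt H)
    (hc : ¬ ((3 : ℕ) : ℤ) ∣ Dt.c) (hμ : ¬ (3 : ℕ) ∣ Units.torsionOrder K)
    (Wd : WeierstrassCurve ℚ) [Wd.IsElliptic] [Wd.IsGloballyMinimal] (Cd : VariableChange ℚ)
    (hWd : Cd • W.quadraticTwist (NumberField.discr K : ℚ) = Wd)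
    -- the certificate: the twist's central value is non-zero and the twist lies in the 3-adic Tamagawa zone
    (hLt : (W.quadraticTwist (NumberField.discr K : ℚ)).entireLFunction 1 ≠ 0)
    (hzone : ∃ q : ℚ, Wd.entireLFunction 1 / (Wd.realPeriodRat : ℂ) = (q : ℂ) ∧
      padicValRat 3 q + 2 * padicValNat 3 Wd.torsionOrder ≤ padicValNat 3 Wd.tamagawaProduct)
    -- the ONE displayed link: (IMC≥∘BDP)ᵍ at the Heegner point, route R1's idiom
    (hLA : ∀ (κ : ZpExtension K 3), κ.IsAnticyclotomic →
      ∀ (γ : Field.absoluteGaloisGroup K) [Fact (κ.IsTopGenerator γ)] (𝔭 : HeightOneSpectrum (𝓞 K))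
        (h𝔭 : (((3 : ℕ) : ℕ) : 𝓞 K) ∈ 𝔭.asIdeal) (he : 𝔭.asIdeal.ramificationIdx (𝓞 ℚ) = 1)
        (hf : 𝔭.asIdeal.inertiaDeg (𝓞 ℚ) = 1),
        X11b.IMCLowerWaldspurgerOnTreeGoodAt 3 κ 𝔭 γ (X11b.embAt K 3 𝔭 h𝔭 he hf) P) :
    BSDp W 3 := by
  have hp2 : (3 : ℕ) ≠ 2 := by decide
  haveI hEK : (W.baseChange K).IsElliptic := isElliptic_baseChange' W K
  have hD0 : (NumberField.discr K : ℚ) ≠ 0 := by exact_mod_cast NumberField.discr_ne_zero K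
  haveI hEt : (W.quadraticTwist (NumberField.discr K : ℚ)).IsElliptic := W.isElliptic_quadraticTwist hD0
  have hgood : W.HasGoodReductionAtPrime 3 := hX.2.1.1
  -- transports to the twist at `3` (`3` splits in `K`): good reduction, `u`, Tamagawa, surjectivity, `L ≠ 0`
  have h3d : ¬ ((3 : ℕ) : ℤ) ∣ NumberField.discr K :=
    Literature.SatisfiesHeegnerHypothesis.not_dvd_discr hK.1 hHp Nat.prime_three (dvd_refl 3)
  have hsq : IsSquare (algebraMap ℚ ℚ_[3] (NumberField.discr K : ℚ)) :=
    X11b.isSquare_discr_padic_of_heegner K hK hHp 3 (dvd_refl 3)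
  have hgoodt : (W.quadraticTwist (NumberField.discr K : ℚ)).HasGoodReductionAtPrime 3 :=
    (AdditiveBranchIMCGordTwoRankOne.HeegnerKolyvagin.hasGoodReductionAtPrime_quadraticTwist_iff_of_isSquare
      W hD0 hsq).mpr hgood
  have hgoodd : Wd.HasGoodReductionAtPrime 3 := by
    rw [← hWd]
    exact (AdditiveBranchIMCGordTwoRankOne.HeegnerKolyvagin.hasGoodReductionAtPrime_smul_iff' _ Cd 3).mpr hgoodt
  have hu : padicValRat 3 (Cd.u : ℚ) = 0 :=
    X11b.padicValRat_u_eq_zero_of_twist_good W 3 (by exact_mod_cast h3d) hgood Cd hWd hgoodd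
  have htam : padicValNat 3 Wd.tamagawaProduct = padicValNat 3 W.tamagawaProduct :=
    O5.TwistTamagawa.padicValNat_tamagawaProduct_twist_of_heegner_three W Wd K hK (by rw [hN]; exact hHN)
      (by exact_mod_cast h3d) Cd hWd
  have hsurjd : Surj Wd 3 := X11b.surj_twist_model W 3 K hsurj Cd hWd
  have hLd' : (W.quadraticTwist (NumberField.discr K : ℚ)).entireLFunction = Wd.entireLFunction := by
    rw [← hWd, entireLFunction_smul]
  have hLd1 : Wd.entireLFunction 1 ≠ 0 := by rw [← hLd']; exact hLt
  -- UPPER half of `E`: Kolyvagin's index bound over `K` BY NAME + the zone of the twist (JSW §7.4.2)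
  have hup : MissingUpperBoundAt W 3 :=
    X11b.missingUpperBoundAt_of_shaIndexBound W 3 N K Dt H ιC P hGZ hKo hGZK hmod hK hHN hP hp2 hc hμ hr hLt
      Wd Cd hWd hu htam htam0 (X8TwistBootstrap.geHalf_of_zone Wd 3 hzone)
      (fun _ hPinf ↦ hB hK hHN ⟨Dt, H, ιC, hP⟩ hPinf Fact.out hp2 hsurj)
  -- LOWER half of `E`: STEP L from (CTL) BY NAME + the displayed link; Wuthrich for the twist (JSW §7.4.1)
  have htw := leHalf_rankZero_of_wuthrich hW hGZK hmod hmodP Wd 3 hp2 hLd1 hgoodd hsurjd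
  have hlow : MissingLowerBoundAt W 3 := by
    refine X11b.missingLowerBoundAt_of_indexLowerBoundAt W 3 N K Dt H ιC P hGZ hKo hGZK hmod hK hHN hP hp2
      hc hμ hr hLt Wd Cd hWd hu htam htw (fun hfinK ↦ ?_)
    haveI := hfinK
    -- the Heegner point is non-torsion (Gross–Zagier); Kolyvagin: `rank E(K) = 1`
    have hPH : IsHeegnerPoint N W K P := ⟨Dt, H, ιC, hP⟩
    have hL0 : W.entireLFunction 1 = 0 := entireLFunction_one_eq_zero_of_analyticRank_eq_one hr
    obtain ⟨-, hderiv⟩ := leadingLCoeff_eq_deriv_of_analyticRank_eq_one hr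
    have hLK : LDerivEK W K ≠ 0 := by
      rw [lDerivEK_eq_deriv_mul W K hmod hL0]
      exact mul_ne_zero hderiv hLt
    have hPinf : ¬ IsOfFinAddOrder P := (lDerivEK_ne_zero_iff_not_isOfFinAddOrder W N K hGZ hK hHN hPH).mp hLK
    obtain ⟨hrkK, -⟩ := hKo hK hHN hPH hPinf
    have hfinKp : Finite (AddCommGroup.primaryComponent (W.baseChange K).sha 3) :=
      Finite.of_injective _ Subtype.val_injective
    -- an anticyclotomic datum EXISTS; the control link is JSW 3.3.1 BY NAME there
    obtain ⟨κ, γ, 𝔭, hκ, hγ, h𝔭⟩ := X11b.exists_anticyclotomic_generator_prime (p := 3) hK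
    haveI : Fact (κ.IsTopGenerator γ) := ⟨hγ⟩
    have hsplit : X11b.SplitsIn K 3 := hHp 3 Fact.out (dvd_refl 3)
    obtain ⟨he, hf⟩ := X11b.degreeOne_of_splitsIn hK.1 hsplit h𝔭
    have hirrK : (W.baseChange K).HasIrreducibleModPGaloisRep 3 :=
      hasIrreducibleModPGaloisRep_baseChange_of_dvd_frobeniusTrace W 3 hp2
        (W.not_dvd_minimalDiscriminantInt_of_hasGoodReductionAtPrime' 3 hX.2.1.1) hX.2.1.2 K hK.1
    have hCTL : X11b.ControlOnTreeGoodAt 3 κ 𝔭 γ (X11b.embAt K 3 𝔭 h𝔭 he hf) P :=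
      X11b.controlOnTreeGoodAt_of_thm331_embAt
        (JetchevSkinnerWan2017.thm331_anticyclotomicControl_of_general h331) (le_refl 3) hX.2.1.1 hK
        hHp hN hHN hirrK κ hκ γ 𝔭 h𝔭 he hf hrkK hfinKp P hPinf
    exact X11b.indexLowerBoundAt_of_onTreeGoodLowerLinks_of_allSplit hK hN hHN (hLA κ hκ γ 𝔭 h𝔭 he hf) hCTL
  exact Typed.bsdp_of_missingPPartAt W 3 hGZK (by omega) (Typed.missingPPartAt_of_lower_of_upper W 3 hlow hup)

/-! ### §3. The ∀∃ reading over X8 ∧ {r_an = 1, surj(3), 3 ∤ ∏c} -/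

/-- **X8 ∧ {`r_an = 1`, `ρ̄_{E,3}` onto, `3 ∤ ∏c`}: `BSD(E,3)` for EVERY such curve, GRANTED the published facts
BY NAME (JSW 3.3.1 `h331`; Gross–Zagier, Kolyvagin, Kolyvagin's index bound at every `(N, W, K)`; Wuthrich
2014 Prop. 21 `hW`; GZK; modularity `hmod`, `hmodP`) and, for every such curve, the EXISTENCE of ONE Heegner
datum with `3` split carrying the displayed link `hLA` and ONE twist certificate (the ∀∃ binder `hcert`: in
print the field with `L(E^{(d)},1) ≠ 0` comes from Bump–Friedberg–Hoffstein 1990 / Waldspurger in root-number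
form, the 3-adic unit `#Ш_an(E^{(d)})` is an Ono–Skinner-type statement OPEN class-wide at the fixed prime `3`
and a finite computation per pair, and the link is the anticyclotomic Eisenstein divisibility at `(3, ±3)` —
OPEN). The rank-ONE twin of k3-c5's `X8.low0_of_twistBootstrapRoad`. CONDITIONAL; closes nothing.
[cite: JetchevSkinnerWan2017, Thm. 3.3.1, §7.4.1–§7.4.2 (arXiv:1512.06894 pp. 11, 30–31)]
[cite: McCallumLMS1991, §1 Theorem (Kolyvagin), p. 296] [cite: Wuthrich2014, Prop. 21 (p. 400)]
[cite: Miller2011LMS, Def. 1.1] -/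
theorem X8.bsdp_rankOne_of_twistCertificateRoad
    (hW : Wuthrich2014.sha_dvd_analyticSha)
    (h331 : JetchevSkinnerWan2017.thm331_anticyclotomicControl_general)
    (hGZ : ∀ (N : ℕ) [NeZero N] (V : WeierstrassCurve ℚ) (K : Type) [Field K] [NumberField K],
      gross_zagier N V K)
    (hKo : ∀ (N : ℕ) [NeZero N] (V : WeierstrassCurve ℚ) (K : Type) [Field K] [NumberField K],
      kolyvagin N V K)
    (hB : ∀ (N : ℕ) [NeZero N] (V : WeierstrassCurve ℚ) (K : Type) [Field K] [NumberField K],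
      Kolyvagin1990_padicValNat_card_sha_le N V K)
    (hGZK : rank_eq_analyticRank_of_analyticRank_le_one) (hmod : hasEntireLFunction_rat)
    (hmodP : nonempty_modularParametrizationData)
    (hcert : ∀ (W : WeierstrassCurve ℚ) [W.IsElliptic] [W.IsGloballyMinimal],
      ClassX8 W 3 → W.analyticRank = 1 → Surj W 3 → ¬ (3 : ℕ) ∣ W.tamagawaProduct →
      ∃ (N : ℕ) (_ : NeZero N) (_ : W.conductorNorm ℤ = N) (K : Type) (_ : Field K) (_ : NumberField K)
        (_ : IsImaginaryQuadratic K) (_ : SatisfiesHeegnerHypothesis N K)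
        (_ : SatisfiesHeegnerHypothesis 3 K)
        (Dt : ModularParametrizationData W N) (H : HeegnerDatum N (NumberField.discr K)) (ιC : K →+* ℂ)
        (P : (W.baseChange K).toAffine.Point)
        (_ : WeierstrassCurve.Affine.Point.map ιC.toRatAlgHom P = heegnerPointComplex Dt H)
        (_ : ¬ ((3 : ℕ) : ℤ) ∣ Dt.c) (_ : ¬ (3 : ℕ) ∣ Units.torsionOrder K)
        (Wd : WeierstrassCurve ℚ) (_ : Wd.IsElliptic) (_ : Wd.IsGloballyMinimal) (Cd : VariableChange ℚ)
        (_ : Cd • W.quadraticTwist (NumberField.discr K : ℚ) = Wd)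
        (_ : (W.quadraticTwist (NumberField.discr K : ℚ)).entireLFunction 1 ≠ 0)
        (_ : ∃ q : ℚ, Wd.entireLFunction 1 / (Wd.realPeriodRat : ℂ) = (q : ℂ) ∧
          padicValRat 3 q + 2 * padicValNat 3 Wd.torsionOrder ≤ padicValNat 3 Wd.tamagawaProduct),
        ∀ (κ : ZpExtension K 3), κ.IsAnticyclotomic →
          ∀ (γ : Field.absoluteGaloisGroup K) [Fact (κ.IsTopGenerator γ)] (𝔭 : HeightOneSpectrum (𝓞 K))
            (h𝔭 : (((3 : ℕ) : ℕ) : 𝓞 K) ∈ 𝔭.asIdeal) (he : 𝔭.asIdeal.ramificationIdx (𝓞 ℚ) = 1)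
            (hf : 𝔭.asIdeal.inertiaDeg (𝓞 ℚ) = 1),
            X11b.IMCLowerWaldspurgerOnTreeGoodAt 3 κ 𝔭 γ (X11b.embAt K 3 𝔭 h𝔭 he hf) P) :
    ∀ (W : WeierstrassCurve ℚ) [W.IsElliptic] [W.IsGloballyMinimal],
      ClassX8 W 3 → W.analyticRank = 1 → Surj W 3 → ¬ (3 : ℕ) ∣ W.tamagawaProduct → BSDp W 3 := by
  intro W _ _ hX hr hs htam0
  obtain ⟨N, hNz, hN, K, _, _, hK, hHN, hHp, Dt, H, ιC, P, hP, hc, hμ, Wd, _, _, Cd, hWd, hLt, hzone, hLA⟩ :=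
    hcert W hX hr hs htam0
  haveI := hNz
  exact X8.bsdp_rankOne_of_acLowerLink_of_twistCertificate hW h331 hGZK hmod hmodP W hX hr hs htam0 N hN K
    (hGZ N W K) (hKo N W K) (hB N W K) hK hHN hHp Dt H ιC P hP hc hμ Wd Cd hWd hLt hzone hLA

/-! ### §4. The LEAF reading on X8 ∧ {surj(3)}, analytic rank ≤ 1: BOTH ranks modulo the SAME displayed link -/

/-- **X8 ∧ {`ρ̄_{E,3}` onto}, `r_an ≤ 1`, with `3 ∤ ∏c` demanded in rank one: `BSD(E,3)` from the two
anticyclotomic twist roads** — rank `0` by k3-c5's TWIST-PAIR bootstrap (`X8TwistBootstrap.X8.low0_of_twistBootstrapRoad`,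
its ∀∃ binder `htwist` VERBATIM) closed by Wuthrich 2014 Prop. 21 (`Typed.X8.bsdp_of_missingLowerBoundAt_of_surj`);
rank `1` by §3 (`hcert`). Both ranks rest on the SAME ONE displayed anticyclotomic Eisenstein link at `(3, ±3)`
(inside the ∀∃ binders) and on per-pair twist data; every other input is a PUBLISHED named fact or a tree
theorem. This is the leaf `WAllCornerX8` RESTRICTED to {surj(3)} ∩ {r = 0 ∨ 3 ∤ ∏c} and CONDITIONAL — NOT the
leaf by name; «beyond-print theorem: NO»; closes nothing; 0 census moves.
[cite: JetchevSkinnerWan2017, Thm. 3.3.1, §7.4.1–§7.4.2] [cite: Wuthrich2014, Prop. 21 (p. 400)]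
[cite: McCallumLMS1991, §1 Theorem (Kolyvagin)] [cite: Miller2011LMS, Def. 1.1] -/
theorem X8.bsdp_of_acTwistRoads_of_surj
    (hW : Wuthrich2014.sha_dvd_analyticSha)
    (h331 : JetchevSkinnerWan2017.thm331_anticyclotomicControl_general)
    (hGZ : ∀ (N : ℕ) [NeZero N] (V : WeierstrassCurve ℚ) (K : Type) [Field K] [NumberField K],
      gross_zagier N V K)
    (hKo : ∀ (N : ℕ) [NeZero N] (V : WeierstrassCurve ℚ) (K : Type) [Field K] [NumberField K],
      kolyvagin N V K)
    (hB : ∀ (N : ℕ) [NeZero N] (V : WeierstrassCurve ℚ) (K : Type) [Field K] [NumberField K],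
      Kolyvagin1990_padicValNat_card_sha_le N V K)
    (hGZK : rank_eq_analyticRank_of_analyticRank_le_one) (hmod : hasEntireLFunction_rat)
    (hmodP : nonempty_modularParametrizationData)
    -- k3-c5's rank-zero twist-pair road (∀∃ over X8 ∧ r0), verbatim
    (htwist : ∀ (W : WeierstrassCurve ℚ) [W.IsElliptic] [W.IsGloballyMinimal],
      ClassX8 W 3 → W.analyticRank = 0 →
      ∃ (N : ℕ) (_ : NeZero N) (_ : W.conductorNorm ℤ = N) (K : Type) (_ : Field K) (_ : NumberField K)
        (_ : IsImaginaryQuadratic K) (_ : SatisfiesHeegnerHypothesis N K)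
        (_ : SatisfiesHeegnerHypothesis 3 K)
        (Dt : ModularParametrizationData W N) (H : HeegnerDatum N (NumberField.discr K)) (ιC : K →+* ℂ)
        (P : (W.baseChange K).toAffine.Point)
        (_ : WeierstrassCurve.Affine.Point.map ιC.toRatAlgHom P = heegnerPointComplex Dt H)
        (_ : ¬ ((3 : ℕ) : ℤ) ∣ Dt.c) (_ : ¬ (3 : ℕ) ∣ Units.torsionOrder K)
        (Wd : WeierstrassCurve ℚ) (_ : Wd.IsElliptic) (_ : Wd.IsGloballyMinimal) (Cd : VariableChange ℚ)
        (_ : Cd • W.quadraticTwist (NumberField.discr K : ℚ) = Wd)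
        (_ : padicValRat 3 (Cd.u : ℚ) = 0) (_ : Wd.analyticRank = 1)
        (_ : padicValNat 3 Wd.tamagawaProduct = padicValNat 3 W.tamagawaProduct)
        (_ : Wd.HasSurjectiveModNGaloisRep 3) (_ : ¬ (3 : ℕ) ∣ Wd.tamagawaProduct)
        (_ : ∀ (κ : ZpExtension K 3), κ.IsAnticyclotomic →
          ∀ (γ : Field.absoluteGaloisGroup K) [Fact (κ.IsTopGenerator γ)] (𝔭 : HeightOneSpectrum (𝓞 K))
            (h𝔭 : (((3 : ℕ) : ℕ) : 𝓞 K) ∈ 𝔭.asIdeal) (he : 𝔭.asIdeal.ramificationIdx (𝓞 ℚ) = 1)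
            (hf : 𝔭.asIdeal.inertiaDeg (𝓞 ℚ) = 1),
            X11b.IMCLowerWaldspurgerOnTreeGoodAt 3 κ 𝔭 γ (X11b.embAt K 3 𝔭 h𝔭 he hf) P)
        (N₁ : ℕ) (_ : NeZero N₁) (K₂ : Type) (_ : Field K₂) (_ : NumberField K₂)
        (_ : IsImaginaryQuadratic K₂) (_ : SatisfiesHeegnerHypothesis N₁ K₂)
        (Dt₂ : ModularParametrizationData Wd N₁) (H₂ : HeegnerDatum N₁ (NumberField.discr K₂))
        (ι₂ : K₂ →+* ℂ) (P₂ : (Wd.baseChange K₂).toAffine.Point)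
        (_ : WeierstrassCurve.Affine.Point.map ι₂.toRatAlgHom P₂ = heegnerPointComplex Dt₂ H₂)
        (_ : ¬ ((3 : ℕ) : ℤ) ∣ Dt₂.c) (_ : ¬ (3 : ℕ) ∣ Units.torsionOrder K₂)
        (_ : (Wd.quadraticTwist (NumberField.discr K₂ : ℚ)).entireLFunction 1 ≠ 0)
        (Wdd : WeierstrassCurve ℚ) (_ : Wdd.IsElliptic) (_ : Wdd.IsGloballyMinimal)
        (Cdd : VariableChange ℚ) (_ : Cdd • Wd.quadraticTwist (NumberField.discr K₂ : ℚ) = Wdd)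
        (_ : padicValRat 3 (Cdd.u : ℚ) = 0)
        (_ : padicValNat 3 Wdd.tamagawaProduct = padicValNat 3 Wd.tamagawaProduct),
        ∃ q : ℚ, Wdd.entireLFunction 1 / (Wdd.realPeriodRat : ℂ) = (q : ℂ) ∧
          padicValRat 3 q + 2 * padicValNat 3 Wdd.torsionOrder ≤ padicValNat 3 Wdd.tamagawaProduct)
    -- this file's rank-one twist-certificate road (∀∃ over X8 ∧ r1 ∧ surj ∧ 3 ∤ ∏c)
    (hcert : ∀ (W : WeierstrassCurve ℚ) [W.IsElliptic] [W.IsGloballyMinimal],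
      ClassX8 W 3 → W.analyticRank = 1 → Surj W 3 → ¬ (3 : ℕ) ∣ W.tamagawaProduct →
      ∃ (N : ℕ) (_ : NeZero N) (_ : W.conductorNorm ℤ = N) (K : Type) (_ : Field K) (_ : NumberField K)
        (_ : IsImaginaryQuadratic K) (_ : SatisfiesHeegnerHypothesis N K)
        (_ : SatisfiesHeegnerHypothesis 3 K)
        (Dt : ModularParametrizationData W N) (H : HeegnerDatum N (NumberField.discr K)) (ιC : K →+* ℂ)
        (P : (W.baseChange K).toAffine.Point)
        (_ : WeierstrassCurve.Affine.Point.map ιC.toRatAlgHom P = heegnerPointComplex Dt H)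
        (_ : ¬ ((3 : ℕ) : ℤ) ∣ Dt.c) (_ : ¬ (3 : ℕ) ∣ Units.torsionOrder K)
        (Wd : WeierstrassCurve ℚ) (_ : Wd.IsElliptic) (_ : Wd.IsGloballyMinimal) (Cd : VariableChange ℚ)
        (_ : Cd • W.quadraticTwist (NumberField.discr K : ℚ) = Wd)
        (_ : (W.quadraticTwist (NumberField.discr K : ℚ)).entireLFunction 1 ≠ 0)
        (_ : ∃ q : ℚ, Wd.entireLFunction 1 / (Wd.realPeriodRat : ℂ) = (q : ℂ) ∧
          padicValRat 3 q + 2 * padicValNat 3 Wd.torsionOrder ≤ padicValNat 3 Wd.tamagawaProduct),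
        ∀ (κ : ZpExtension K 3), κ.IsAnticyclotomic →
          ∀ (γ : Field.absoluteGaloisGroup K) [Fact (κ.IsTopGenerator γ)] (𝔭 : HeightOneSpectrum (𝓞 K))
            (h𝔭 : (((3 : ℕ) : ℕ) : 𝓞 K) ∈ 𝔭.asIdeal) (he : 𝔭.asIdeal.ramificationIdx (𝓞 ℚ) = 1)
            (hf : 𝔭.asIdeal.inertiaDeg (𝓞 ℚ) = 1),
            X11b.IMCLowerWaldspurgerOnTreeGoodAt 3 κ 𝔭 γ (X11b.embAt K 3 𝔭 h𝔭 he hf) P)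
    (W : WeierstrassCurve ℚ) [W.IsElliptic] [W.IsGloballyMinimal] (hX : ClassX8 W 3)
    (hr : W.analyticRank ≤ 1) (hs : Surj W 3) (htam0 : W.analyticRank = 1 → ¬ (3 : ℕ) ∣ W.tamagawaProduct) :
    BSDp W 3 := by
  rcases Nat.lt_or_ge W.analyticRank 1 with h0 | h1
  · have hr0 : W.analyticRank = 0 := by omega
    exact Typed.X8.bsdp_of_missingLowerBoundAt_of_surj W 3 hW hGZK hmod hX hs hr0
      (X8TwistBootstrap.X8.low0_of_twistBootstrapRoad h331 hGZ hKo hB hGZK hmod hmodP htwist W hX hr0)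
  · have hr1 : W.analyticRank = 1 := le_antisymm hr h1
    exact X8.bsdp_rankOne_of_twistCertificateRoad hW h331 hGZ hKo hB hGZK hmod hmodP hcert W hX hr1 hs
      (htam0 hr1)

end Summit.BirchSwinnertonDyer.BirchSwinnertonDyer.Theorems.X8TwistCertificate

end
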